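import Summits.Ventures.LatticeQCDFlow.TrivializingMaps.FisherZeroNearCouplingSharp
import Summits.Ventures.LatticeQCDFlow.TrivializingMaps.FisherStaircaseZeroSet
import Summits.Ventures.LatticeQCDFlow.TrivializingMaps.WilsonStaircaseCountExplicit

/-!
HONEST FRAMING: exact (Metropolis-corrected) sampling algorithms for lattice gauge theory; figures
of merit are autocorrelation/cost numbers at stated couplings and volumes; no continuum-physics
claim.

# StaircaseMeanActionLaw — ONE `η`-margined stage of the perturbative staircase lowers the mean
# action by at most `4 · (half-range) · log(1/η)`; for the Wilson action the mean plaquette action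
# drops by at most `4n·log(1/η)` per stage, in every volume (lean-2 GEN-7, ours)

Venture-side (OURS).  Cell `lqcd-flow` (pub-lqcd), unit `pub-lqcd-lean-2-g7`, 2026-08-22.

A law of the coupling-continuation STAIRCASE (THEORY-1 THEOREM S family, rows 92a–92e) that contains
NO zero location at all.  Three tree facts combine:

1. the fluctuation relation on the real axis — `(Z′/Z)(x) = -⟨S⟩_x` and `(Z′/Z)′(x) = Var_x(S)`
   (`FisherStaircaseCumulants`), hence (fundamental theorem of calculus)
   **`meanAction_sub_eq_integral_variance`**: `⟨S⟩_a − ⟨S⟩_b = ∫_a^b Var_t(S) dt`;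
2. the several-zeros form of THEOREM S — `∫_{x₀}^{x_K} dt/dist(t, F_Z) ≤ K·log(1/η)` for every
   `η`-margined admissible staircase (`Staircase.actionZ_integral_inv_infDist_le`, row 92d);
3. the sharp near-coupling law — `dist(t, F_Z) ≤ 4|b|/Var_t(S)` for `|S∘ι − c| ≤ b`
   (`infDist_actionZ_zeroSet_le`, this generation), i.e. `Var_t(S)/(4|b|) ≤ 1/dist(t, F_Z)`.

* **`Staircase.meanAction_drop_le`** — for every smooth action with `|S∘ι − c| ≤ b`, every volume,
  every `0 < η < 1` and every `η`-margined admissible staircase `x₀ ≤ … ≤ x_K`: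
  `⟨S⟩_{x₀} − ⟨S⟩_{x_K} ≤ 4|b| · K · log(1/η)` (mean action in the ensembles `𝒵⁻¹e^{-xS}D[U]`);
* **`wilson_meanAction_drop_le`** — for the `SU(n)` Wilson action (`b = c = n·#plaq`):
  `⟨S_W⟩_{x₀} − ⟨S_W⟩_{x_K} ≤ 4n·#plaq·K·log(1/η)`, expectations under `wilsonMeasure ρ₀ x`; per
  plaquette: the mean plaquette action `⟨Re tr(1 − U_p)⟩` can decrease by at most `4n·log(1/η)` per
  stage, in EVERY volume and dimension.

Reading (value-free): the staircase's progress is paid in the drop of the mean action density;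
continuing from `β = 0` (density `n`) to a coupling where the density is `e` costs at least
`(n − e)/(4n·log(1/η))` stages.  NOT CLAIMED: the value of any mean action at any coupling;
sharpness; anything about other continuation schemes; cost / autocorrelation / continuum.
-/

open MeasureTheory ProbabilityTheory Filter Topology Complex Set Metric intervalIntegral
open Literature.MathematicalPhysics.QuantumFieldTheory
open Literature.MathematicalPhysics.QuantumFieldTheory.Luscher2010
open Literature.MathematicalPhysics.QuantumFieldTheory.WilsonFlow (coeConfig continuous_coeConfig)
open scoped Matrix Matrix.Norms.Frobenius ContDiff

namespace Summit.Ventures.LatticeQCDFlow.TrivializingMaps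

section ActionZ

variable {d L n : ℕ} [NeZero L] {S : AmbConfig d L n → ℝ}

/-- The variance of the action along the real coupling axis is a continuous function of the
coupling (it is the derivative of the holomorphic `Z′/Z` restricted to the real axis). [ours] -/
theorem continuous_variance_boltzmann (hS : ContDiff ℝ ∞ S) :
    Continuous fun t : ℝ => variance (fun U => S (coeConfig U))
      (boltzmannMeasure fun U : GaugeConfig d L (Matrix.specialUnitaryGroup (Fin n) ℂ) =>
        t * S (coeConfig U)) := by
  set Z := complexMGF (fun U => -S (coeConfig U))
    (trivialMeasure (Matrix.specialUnitaryGroup (Fin n) ℂ) d L) with hZdef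
  have hZd : Differentiable ℂ Z := differentiable_actionZ hS
  have hU : IsOpen {w : ℂ | Z w ≠ 0} := isOpen_ne_fun hZd.continuous continuous_const
  have hG : DifferentiableOn ℂ (fun w => deriv Z w / Z w) {w : ℂ | Z w ≠ 0} := fun w hw =>
    (((differentiable_deriv_actionZ hS) w).div (hZd w) hw).differentiableWithinAt
  have hG' : DifferentiableOn ℂ (deriv fun w => deriv Z w / Z w) {w : ℂ | Z w ≠ 0} := hG.deriv hU
  have hUre : ∀ y : ℝ, (y : ℂ) ∈ {w : ℂ | Z w ≠ 0} := fun y =>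
    actionZ_ofReal_ne_zero (d := d) (L := L) (n := n) hS y
  have hc : Continuous fun t : ℝ => deriv (fun w => deriv Z w / Z w) (t : ℂ) :=
    hG'.continuousOn.comp_continuous Complex.continuous_ofReal hUre
  have hre : Continuous fun t : ℝ => (deriv (fun w => deriv Z w / Z w) (t : ℂ)).re :=
    Complex.continuous_re.comp hc
  refine hre.congr fun t => ?_
  simp only [hZdef]
  rw [deriv_logDeriv_actionZ_ofReal_eq_variance (d := d) (L := L) (n := n) hS t, Complex.ofReal_re]

/-- **Fluctuation relation, integrated: `⟨S⟩_a − ⟨S⟩_b = ∫_a^b Var_t(S) dt`** along the real coupling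
axis (mean and variance in the ensembles `𝒵⁻¹e^{-tS}D[U]`; every smooth action, every volume).
[folklore; `d⟨S⟩_t/dt = -Var_t(S)`] -/
theorem meanAction_sub_eq_integral_variance (hS : ContDiff ℝ ∞ S) (a b : ℝ) :
    (∫ U, S (coeConfig U) ∂(boltzmannMeasure fun U :
        GaugeConfig d L (Matrix.specialUnitaryGroup (Fin n) ℂ) => a * S (coeConfig U))) -
      (∫ U, S (coeConfig U) ∂(boltzmannMeasure fun U :
        GaugeConfig d L (Matrix.specialUnitaryGroup (Fin n) ℂ) => b * S (coeConfig U))) =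
      ∫ t in a..b, variance (fun U => S (coeConfig U))
        (boltzmannMeasure fun U : GaugeConfig d L (Matrix.specialUnitaryGroup (Fin n) ℂ) =>
          t * S (coeConfig U)) := by
  set Z := complexMGF (fun U => -S (coeConfig U))
    (trivialMeasure (Matrix.specialUnitaryGroup (Fin n) ℂ) d L) with hZdef
  set G : ℂ → ℂ := fun w => deriv Z w / Z w with hGdef
  have hZd : Differentiable ℂ Z := differentiable_actionZ hS
  have hU : IsOpen {w : ℂ | Z w ≠ 0} := isOpen_ne_fun hZd.continuous continuous_const
  have hG : DifferentiableOn ℂ G {w : ℂ | Z w ≠ 0} := fun w hw =>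
    (((differentiable_deriv_actionZ hS) w).div (hZd w) hw).differentiableWithinAt
  have hUre : ∀ y : ℝ, (y : ℂ) ∈ {w : ℂ | Z w ≠ 0} := fun y =>
    actionZ_ofReal_ne_zero (d := d) (L := L) (n := n) hS y
  -- the complex FTC along the real axis: `∫_a^b G'(t) dt = G(b) - G(a)`
  have hderiv : ∀ t ∈ uIcc a b, HasDerivAt (fun y : ℝ => G (y : ℂ)) (deriv G (t : ℂ)) t := by
    intro t _
    have h : HasDerivAt G (deriv G (t : ℂ)) (t : ℂ) :=
      ((hG _ (hUre t)).differentiableAt (hU.mem_nhds (hUre t))).hasDerivAt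
    exact h.comp_ofReal
  have hcont : Continuous fun t : ℝ => deriv G (t : ℂ) :=
    (hG.deriv hU).continuousOn.comp_continuous Complex.continuous_ofReal hUre
  have hftc := intervalIntegral.integral_eq_sub_of_hasDerivAt hderiv (hcont.intervalIntegrable a b)
  -- rewrite both sides in real terms
  have hvar : ∀ t : ℝ, deriv G (t : ℂ) = ((variance (fun U => S (coeConfig U))
      (boltzmannMeasure fun U : GaugeConfig d L (Matrix.specialUnitaryGroup (Fin n) ℂ) =>
        t * S (coeConfig U)) : ℝ) : ℂ) := fun t =>
    deriv_logDeriv_actionZ_ofReal_eq_variance (d := d) (L := L) (n := n) hS t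
  have hmean : ∀ t : ℝ, G (t : ℂ) = -((∫ U, S (coeConfig U) ∂(boltzmannMeasure fun U :
      GaugeConfig d L (Matrix.specialUnitaryGroup (Fin n) ℂ) => t * S (coeConfig U)) : ℝ) : ℂ) :=
    fun t => logDeriv_actionZ_ofReal_eq_neg_integral (d := d) (L := L) (n := n) hS t
  simp_rw [hvar] at hftc
  rw [intervalIntegral.integral_ofReal, hmean, hmean] at hftc
  have h := congrArg Complex.re hftc
  simp only [Complex.ofReal_re, Complex.sub_re, Complex.neg_re] at h
  linarith

namespace Staircase

/-- **ONE STAGE COSTS AT MOST `4|b|·log(1/η)` OF MEAN ACTION.**  For a smooth action with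
`|S∘ι − c| ≤ b`, `0 < η < 1` and an `η`-margined admissible staircase `x₀ ≤ … ≤ x_K` (stage `k`
summable at `x_k + Δ_k/(1-η)`): `⟨S⟩_{x₀} − ⟨S⟩_{x_K} ≤ 4|b|·K·log(1/η)`. [ours] -/
theorem meanAction_drop_le (hS : ContDiff ℝ ∞ S) {c b : ℝ}
    (hb : ∀ U : GaugeConfig d L (Matrix.specialUnitaryGroup (Fin n) ℂ), |S (coeConfig U) - c| ≤ b)
    {η : ℝ} (hη0 : 0 < η) (hη1 : η < 1) {K : ℕ} {x : ℕ → ℝ} (hmono : ∀ k < K, x k ≤ x (k + 1))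
    (hadm : ∀ k < K, Summable fun j : ℕ => (j.factorial : ℂ)⁻¹ *
      iteratedDeriv j (fun w => deriv (complexMGF (fun U => -S (coeConfig U))
          (trivialMeasure (Matrix.specialUnitaryGroup (Fin n) ℂ) d L)) w /
        complexMGF (fun U => -S (coeConfig U))
          (trivialMeasure (Matrix.specialUnitaryGroup (Fin n) ℂ) d L) w) (x k) *
      (((x k + (x (k + 1) - x k) / (1 - η) : ℝ) : ℂ) - x k) ^ j) :
    (∫ U, S (coeConfig U) ∂(boltzmannMeasure fun U :
        GaugeConfig d L (Matrix.specialUnitaryGroup (Fin n) ℂ) => x 0 * S (coeConfig U))) -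
      (∫ U, S (coeConfig U) ∂(boltzmannMeasure fun U :
        GaugeConfig d L (Matrix.specialUnitaryGroup (Fin n) ℂ) => x K * S (coeConfig U))) ≤
      4 * |b| * (K * Real.log (1 / η)) := by
  set F : Set ℂ := {s : ℂ | complexMGF (fun U => -S (coeConfig U))
      (trivialMeasure (Matrix.specialUnitaryGroup (Fin n) ℂ) d L) s = 0} with hFdef
  set v : ℝ → ℝ := fun t => variance (fun U => S (coeConfig U))
      (boltzmannMeasure fun U : GaugeConfig d L (Matrix.specialUnitaryGroup (Fin n) ℂ) =>
        t * S (coeConfig U)) with hvdef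
  have hx0K : x 0 ≤ x K := chain_le_last hmono
  have hlog : 0 ≤ Real.log (1 / η) := Real.log_nonneg (by rw [le_div_iff₀ hη0]; linarith)
  have hvc : Continuous v := continuous_variance_boltzmann (d := d) (L := L) (n := n) hS
  have hv0 : ∀ t, 0 ≤ v t := fun t => variance_nonneg _ _
  have hB : 0 ≤ 4 * |b| := by positivity
  rw [meanAction_sub_eq_integral_variance (d := d) (L := L) (n := n) hS (x 0) (x K)]
  -- Either some variance is positive (then `F ≠ ∅`) or all vanish.
  by_cases hF : F.Nonempty
  · obtain ⟨s₀, hs₀⟩ := hF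
    have hstair := actionZ_integral_inv_infDist_le (d := d) (L := L) (n := n) hS hs₀ hη0 hη1
      hmono hadm
    -- `F` is closed and misses the real axis, so `t ↦ (dist(t,F))⁻¹` is continuous
    have hFc : IsClosed F := isClosed_actionZ_zeroSet (d := d) (L := L) (n := n) hS
    have hpos : ∀ t : ℝ, 0 < infDist (t : ℂ) F := fun t =>
      (hFc.notMem_iff_infDist_pos ⟨s₀, hs₀⟩).1
        (actionZ_ofReal_ne_zero (d := d) (L := L) (n := n) hS t)
    have hic : Continuous fun t : ℝ => (infDist (t : ℂ) F)⁻¹ :=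
      ((continuous_infDist_pt F).comp Complex.continuous_ofReal).inv₀ fun t => (hpos t).ne'
    -- pointwise: `v t / (4|b|) ≤ (dist(t,F))⁻¹`
    have hpt : ∀ t ∈ Icc (x 0) (x K), v t / (4 * |b|) ≤ (infDist (t : ℂ) F)⁻¹ := by
      intro t _
      rcases (hv0 t).eq_or_lt with hz | hvpos
      · rw [← hz, zero_div]; exact inv_nonneg.mpr infDist_nonneg
      · have hle := infDist_actionZ_zeroSet_le (d := d) (L := L) (n := n) hS hb t hvpos
        rcases hB.eq_or_lt with hb0 | hbpos
        · rw [← hb0, div_zero]; exact inv_nonneg.mpr infDist_nonneg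
        · calc v t / (4 * |b|) = (4 * |b| / v t)⁻¹ := by rw [inv_div]
            _ ≤ (infDist (t : ℂ) F)⁻¹ := inv_anti₀ (hpos t) hle
    have hmono_int : ∫ t in x 0..x K, v t / (4 * |b|) ≤ ∫ t in x 0..x K, (infDist (t : ℂ) F)⁻¹ :=
      intervalIntegral.integral_mono_on hx0K ((hvc.div_const _).intervalIntegrable _ _)
        (hic.intervalIntegrable _ _) hpt
    have hdiv : ∫ t in x 0..x K, v t / (4 * |b|) = (∫ t in x 0..x K, v t) / (4 * |b|) :=
      intervalIntegral.integral_div _ _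
    rcases hB.eq_or_lt with hb0 | hbpos
    · -- `b = 0`: the action is a.s. constant, all variances vanish, both sides are `0 ≤ …`
      have hvz : ∀ t, v t = 0 := by
        intro t
        by_contra hne
        have hvpos : 0 < v t := lt_of_le_of_ne (hv0 t) (Ne.symm hne)
        obtain ⟨s, hs, hsz⟩ := exists_actionZ_eq_zero_near_norm_le (d := d) (L := L) (n := n)
          hS hb t hvpos
        rw [← hb0, zero_div] at hs
        have hst : (s : ℂ) = (t : ℂ) := by simpa [sub_eq_zero] using hs
        exact actionZ_ofReal_ne_zero (d := d) (L := L) (n := n) hS t (hst ▸ hsz)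
      simp only [hvdef] at hvz
      simp_rw [hvz, intervalIntegral.integral_zero]
      exact mul_nonneg hB (mul_nonneg (Nat.cast_nonneg K) hlog)
    · rw [hdiv, div_le_iff₀ hbpos] at hmono_int
      calc ∫ t in x 0..x K, v t ≤ (∫ t in x 0..x K, (infDist (t : ℂ) F)⁻¹) * (4 * |b|) := hmono_int
        _ ≤ K * Real.log (1 / η) * (4 * |b|) := mul_le_mul_of_nonneg_right hstair hB
        _ = 4 * |b| * (K * Real.log (1 / η)) := by ring
  · -- no zero at all: every variance vanishes
    have hvz : ∀ t, v t = 0 := by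
      intro t
      by_contra hne
      have hvpos : 0 < v t := lt_of_le_of_ne (hv0 t) (Ne.symm hne)
      obtain ⟨s, _, hs⟩ := exists_actionZ_eq_zero_near_norm_le (d := d) (L := L) (n := n) hS
        hb t hvpos
      exact hF ⟨s, hs⟩
    simp only [hvdef] at hvz
    simp_rw [hvz, intervalIntegral.integral_zero]
    exact mul_nonneg hB (mul_nonneg (Nat.cast_nonneg K) hlog)

end Staircase

end ActionZ

/-! ## The Wilson action: the mean plaquette action drops by at most `4n·log(1/η)` per stage -/

section Wilson

variable {d L n : ℕ} [NeZero L]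

/-- **`⟨S_W⟩_{x₀} − ⟨S_W⟩_{x_K} ≤ 4n·#plaq·K·log(1/η)`** for every `η`-margined admissible staircase
of re-expanded flow-constant series of the `SU(n)` Wilson action (expectations under
`wilsonMeasure ρ₀ x`; every `d`, `L`, `n`): per plaquette, the mean plaquette action decreases by at
most `4n·log(1/η)` per stage. [ours] -/
theorem wilson_meanAction_drop_le {η : ℝ} (hη0 : 0 < η) (hη1 : η < 1) {K : ℕ} {x : ℕ → ℝ}
    (hmono : ∀ k < K, x k ≤ x (k + 1))
    (hadm : ∀ k < K, Summable fun j : ℕ => (j.factorial : ℂ)⁻¹ *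
      iteratedDeriv j (fun w => deriv (complexMGF (fun U => -ambWilsonAction (coeConfig U))
          (trivialMeasure (Matrix.specialUnitaryGroup (Fin n) ℂ) d L)) w /
        complexMGF (fun U => -ambWilsonAction (coeConfig U))
          (trivialMeasure (Matrix.specialUnitaryGroup (Fin n) ℂ) d L) w) (x k) *
      (((x k + (x (k + 1) - x k) / (1 - η) : ℝ) : ℂ) - x k) ^ j) :
    (∫ U, wilsonAction (StrongCoupling.defRep n) U
        ∂(wilsonMeasure (d := d) (L := L) (StrongCoupling.defRep n) (x 0))) -
      (∫ U, wilsonAction (StrongCoupling.defRep n) U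
        ∂(wilsonMeasure (d := d) (L := L) (StrongCoupling.defRep n) (x K))) ≤
      4 * (n * Fintype.card (Plaquette d L)) * (K * Real.log (1 / η)) := by
  have h := Staircase.meanAction_drop_le (d := d) (L := L) (n := n) contDiff_ambWilsonAction
    (c := n * Fintype.card (Plaquette d L)) (b := n * Fintype.card (Plaquette d L))
    abs_ambWilsonAction_sub_le hη0 hη1 hmono hadm
  rw [StrongCoupling.boltzmannMeasure_smul_ambWilsonAction (x 0),
    StrongCoupling.boltzmannMeasure_smul_ambWilsonAction (x K)] at h
  simp_rw [StrongCoupling.ambWilsonAction_coeConfig] at h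
  rwa [abs_of_nonneg (by positivity)] at h

end Wilson

end Summit.Ventures.LatticeQCDFlow.TrivializingMaps
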